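import Summits.HodgeConjecture.HodgeConjecture.Theorems.Ring2AbelianAllAndreFibreClassBalancedNoGo
import HarnessLib

/-!
# Ring 2 · sub-cell AbelianAll (ALL ABELIAN VARIETIES), André axis, part XV-d — the no-go of part XV-a EXTENDED:
# `j_s^* ∘ j_{t*} = 0` in every degree; correspondences balanced UP TO A FIBRE-KILLED CLASS (e.g. proportionally
# balanced: cycles over a curve of `S × S`), and correspondences through a fibre of either projection
# (`𝒳_{t₁} × 𝒳`, `𝒳 × 𝒳_{t₁}`) never witness a clause of (β′_f) — in print: a witness must DOMINATE `S × S`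

HONEST FRAMING (page 1, verbatim): **research route, not a corollary; conditional on HC_CM plus one named
minimal statement.** Cell line: research route conditional on HC_CM; not a corollary; Q11.4-sentence-2
already refuted in dim ≥ 3. Nothing in this file proves a case of the Hodge conjecture for an abelian variety.
`HC_CM` = `Theses.RankFourFaces.CMAbelianHodge` (a BINDER), item `Theses.RankFourFaces.CMToAbelian` (stmt-16267)
OPEN and not closed here. Seat `pub-hodge-ring2-ab-andre-2`, gen 7 (continues part XV-a; owed item o17).

## What is proved (theorems only; no definition, no named fact, no sorry)

`f : 𝒳 ⟶ S` a compact pencil of abelian `d`-folds, `[𝒳_t] = j_{t*}1`, `L_t = j_{t*} j_t^* = ∪[𝒳_t]`.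

* §1 **`[𝒳_t] ∪ j_{t*} a = 0` and `j_s^*(j_{t*} a) = 0` for EVERY fibre class `a ∈ H²ᵖ(𝒳_t)` and all `s, t`**
  (`cupProduct_fiberGysin_fiberGysin_one_eq_zero`, `map_fiberι_fiberGysin_eq_zero`): projection formula
  `j_{t*}(j_t^*[𝒳_t] ∪ a) = [𝒳_t] ∪ j_{t*}a` with `j_t^*[𝒳_t] = 0` (part XV-a), then the kernel identity (κ)
  (`fibreGysinKernelOn_holds`, a tree theorem): `L_t(j_{t*}a) = 0 ⟹ j_s^*(j_{t*}a) = 0`. So `Im j_{t*} ⊆ ⋂_s ker j_s^*`.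
* §2 **Raw vanishing below the fibre dimension** (`gysinMap_cupProduct_map_eq_zero_of_lt`): for any orientations,
  `pr_{W!}(y ∪ pr_W^* x) = 0` when `deg y < 2 dim X` (the push-forward lands in `H_{>2 dim W}(W(ℂ)) = 0`).
* §3 **Balanced up to a fibre-killed class** (`map_fiberι_corrClassAction_fiberGysin_eq_zero_of_balanced'`,
  `not_fibreClassLefschetz_clause_of_balanced'`): if `γ ∪ pr₂^*[𝒳_{t₀}] = γ ∪ pr₁^* G` for SOME `G ∈ H²(𝒳)` with
  `j_s^* G = 0` for all `s` — e.g. `G = c · [𝒳_{t₁}]` (PROPORTIONALLY balanced, `c = 0` allowed: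
  `…_of_propBalanced`), or any `G ∈ L¹H²` — then `j_s^* γ^* L_t = 0` and `γ^*` witnesses no clause `p ≤ d`.
* §4 **Through a fibre of the second projection** (`corrClassAction_fiberGysin_eq_zero_of_sndVertical`): for
  `γ = pr₂^*(j_{t₁*} a) ∪ γ₁` ("supported on `𝒳 × 𝒳_{t₁}`"), `γ^* ∘ L_t = 0` outright (`[𝒳_t] ∪ j_{t₁*}a = 0`).
* §5 **Through a fibre of the first projection** (`map_fiberι_corrClassAction_eq_zero_of_fstVertical`): for
  `γ = pr₁^*(j_{t₁*} a) ∪ γ₁` ("supported on `𝒳_{t₁} × 𝒳`"), `j_s^* ∘ γ^* = 0` on ALL classes (projection formula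
  `pr_{1!}(pr₁^* J ∪ Y) = J ∪ pr_{1!} Y` and §1, or §2 in low degrees).

## Reading (RING2-MAP §AbelianAll (ab-andre-2, gen 7); o17)

In print, let `Z ⊂ 𝒳 × 𝒳` be an irreducible codimension-`d` subvariety and `C` the closure of its image in
`S × S`. If `C` is a point or a curve: either `C ⊂ {s₀} × S` (then `[Z] ∈ ∑ pr₁^*(j_{s₀*}α) ∪ pr₂^*β`, §5), or
`C ⊂ S × {t₀}` (§4), or both projections `C → S` are finite of degrees `d₁, d₂ ≥ 1`, in which case the slices
`Z_c`, `c ∈ C`, are algebraically equivalent and `[Z] ∪ pr₁^*[𝒳_t] = d₁[Z_c]`, `[Z] ∪ pr₂^*[𝒳_t] = d₂[Z_c]`: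
`Z` is PROPORTIONALLY BALANCED (§3). By linearity of `Z ↦ Z^*` a witness of a clause of (β′_f) may be pruned of
all such components. CONCLUSION (kernel: the four cohomological shapes are excluded unconditionally; print: the
dictionary cycle ↦ shape uses `[𝒳_t] = f^*[t]` and algebraic equivalence of slices, Fulton 10.3): **every
algebraic witness of the fibre-class Lefschetz node has a component whose support DOMINATES `S × S` and whose
row- and column-slices `Z ∩ (𝒳_t × 𝒳)`, `Z ∩ (𝒳 × 𝒳_t)` are NOT cohomologous up to scalar** — on top of part
XIV/XV-b's "not a product through algebraic fibre classes unless (N_p)". For the W₆ habitat: a `(6+2)`-dimensional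
family, over `S × S`, of 6-cycles `z_{s,t} ⊂ 𝒳_s × 𝒳_t` (degree-0 correspondences between DIFFERENT fibres)
transporting the invariant classes, with unequal row/column degenerations. No such cycle is known in print for a
non-isotrivial pencil (for an isotrivial one the graph of the isotrivialisation is exactly of this shape).

References: Abdulali1994FamiliesAV (Conj. 5.3, Thm. 5.5, p. 1130); VoisinHodgeII2003 ((10.7), §9.2.4);
FultonYoungTableaux1997 (App. B §B.1 (5)–(6)); Fulton1998 (§10.3 Example 10.3.2, §19.1); HatcherAT2002 (§3.2
Prop. 3.10, Thm. 3.11, §3.3 Thm. 3.26, p. 241); DeligneHodgeII1971 (4.1.1); DeningerMurre1991; Kunnemann1993.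
-/

noncomputable section

set_option linter.dupNamespace false

namespace Summit.HodgeConjecture.HodgeConjecture.Ring2.AbelianAll

open CategoryTheory AlgebraicGeometry MonoidalCategory CartesianMonoidalCategory
open Literature.AlgebraicGeometry Literature.AlgebraicGeometry.Motives
open Literature.AlgebraicGeometry.HodgeTheory
open Literature.AlgebraicTopology.SingularHomology (singularCohomology singularHomology cupProduct capProduct
  cupProduct_assoc cupProduct_gradedComm_holds cupProduct_capProduct capProduct_map gysinMap
  gysinMap_cupProduct_map gysinMap_map_cupProduct capProduct_gysinMap poincareDualityMap_apply
  HomologicalOrientation)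

variable {𝒳 S : SchemeOver ℂ}

/-! ## §1 `[𝒳_t] ∪ j_{t*} a = 0` and `j_s^* ∘ j_{t*} = 0` in every degree -/

/-- **`j_{t*} a ∪ [𝒳_t] = 0` for every `a ∈ H²ᵖ(𝒳_t(ℂ))`**: `j_{t*}(j_t^*[𝒳_t] ∪ a) = [𝒳_t] ∪ j_{t*} a`
(projection formula, `complexGysin_cup`) and `j_t^*[𝒳_t] = 0` (part XV-a); graded commutativity (even degrees).
[cite: FultonYoungTableaux1997, Appendix B §B.1 (6)] [cite: Fulton1998, §10.3 Example 10.3.2] -/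
theorem cupProduct_fiberGysin_fiberGysin_one_eq_zero {d : ℕ} {f : 𝒳 ⟶ S} (hf : IsCompactAbelianPencil f d)
    (t : ComplexPoints S) {p : ℕ} (a : complexBetti (fiberOver f t) (2 * p)) :
    cupProduct (show 2 * (p + 1) + 2 * (0 + 1) = 2 * (p + 1 + 1) by ring) (fiberGysin hf t p a)
      (fiberGysin hf t 0 (singularCohomology.one ℂ (ComplexPoints (fiberOver f t)))) = 0 := by
  have h := complexGysin_cup (μ := complexOrientationFamily) hasPoincareDuality_complexOrientationFamily
    (hf.isSmoothProjective_fiberOver t) hf.isSmoothProjective_total (fiberι f t)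
    (rfl : 2 * (0 + 1) + 2 * p = 2 * (0 + 1) + 2 * p)
    (show 2 * (0 + 1) + 2 * p + 2 * (d + 1) = 2 * (p + 1 + 1) + 2 * d by ring)
    (show 2 * p + 2 * (d + 1) = 2 * (p + 1) + 2 * d by ring)
    (show 2 * (0 + 1) + 2 * (p + 1) = 2 * (p + 1 + 1) by ring)
    (fiberGysin hf t 0 (singularCohomology.one ℂ (ComplexPoints (fiberOver f t)))) a
  rw [map_fiberι_fiberGysin_one_eq_zero hf t t, map_zero, LinearMap.zero_apply, map_zero] at h
  have h' : cupProduct (show 2 * (0 + 1) + 2 * (p + 1) = 2 * (p + 1 + 1) by ring)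
      (fiberGysin hf t 0 (singularCohomology.one ℂ (ComplexPoints (fiberOver f t)))) (fiberGysin hf t p a) = 0 := by
    rw [eq_comm] at h
    exact h
  rw [cupProduct_gradedComm_holds ℂ _ (show 2 * (p + 1) + 2 * (0 + 1) = 2 * (p + 1 + 1) by ring)
    (show 2 * (0 + 1) + 2 * (p + 1) = 2 * (p + 1 + 1) by ring), h', smul_zero]

/-- **`j_s^*(j_{t*} a) = 0` for every `a ∈ H²ᵖ(𝒳_t(ℂ))` and all `s, t`: Gysin images die on every fibre**
(`Im j_{t*} ⊆ ⋂_s ker j_s^* = L¹H`). From §1's `L_t(j_{t*} a) = j_{t*}a ∪ [𝒳_t] = 0` and the kernel identity (κ)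
(`fibreGysinKernelOn_holds`: `L_t W = 0 ⟹ j_s^* W = 0`, Deligne's theorem on the carriers). For `s ≠ t` this is the
disjointness of fibres; for `s = t` the self-intersection formula with trivial normal bundle — both obtained here
without normal-bundle calculus. [cite: DeligneHodgeII1971, Thm. 4.1.1 and 4.2.6] [cite: Fulton1998, §10.3 Example 10.3.2]
[cite: VoisinHodgeII2003, §4.3.1 Thm. 4.18] -/
theorem map_fiberι_fiberGysin_eq_zero {d : ℕ} {f : 𝒳 ⟶ S} (hf : IsCompactAbelianPencil f d) {p : ℕ}
    (t s : ComplexPoints S) (a : complexBetti (fiberOver f t) (2 * p)) :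
    complexBetti.map (fiberι f s) (2 * (p + 1)) (fiberGysin hf t p a) = 0 := by
  refine fibreGysinKernelOn_holds hf (p + 1) t s (fiberGysin hf t p a) ?_
  rw [fiberGysin_map_fiberι_eq_cupProduct hf t, cupProduct_fiberGysin_fiberGysin_one_eq_zero hf t a]

/-- `j_s^*(y ∪ j_{t*} a) = 0` for every class `y` of the total space. [cite: HatcherAT2002, §3.2 Prop. 3.10] -/
theorem map_fiberι_cupProduct_fiberGysin_eq_zero {d : ℕ} {f : 𝒳 ⟶ S} (hf : IsCompactAbelianPencil f d) {p : ℕ}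
    (t s : ComplexPoints S) (a : complexBetti (fiberOver f t) (2 * p)) {k b : ℕ} (h : k + 2 * (p + 1) = b)
    (y : complexBetti 𝒳 k) :
    complexBetti.map (fiberι f s) b (cupProduct h y (fiberGysin hf t p a)) = 0 := by
  rw [complexBetti.map_cupProduct, map_fiberι_fiberGysin_eq_zero hf t s a, map_zero]

/-- `j_s^*(j_{t*} a ∪ y) = 0` for every class `y` of the total space. [cite: HatcherAT2002, §3.2 Prop. 3.10] -/
theorem map_fiberι_cupProduct_fiberGysin_eq_zero' {d : ℕ} {f : 𝒳 ⟶ S} (hf : IsCompactAbelianPencil f d) {p : ℕ}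
    (t s : ComplexPoints S) (a : complexBetti (fiberOver f t) (2 * p)) {k b : ℕ} (h : 2 * (p + 1) + k = b)
    (y : complexBetti 𝒳 k) :
    complexBetti.map (fiberι f s) b (cupProduct h (fiberGysin hf t p a) y) = 0 := by
  rw [complexBetti.map_cupProduct, map_fiberι_fiberGysin_eq_zero hf t s a, map_zero, LinearMap.zero_apply]

/-! ## §2 Raw vanishing: `pr_{W!}(y ∪ pr_W^* x) = 0` below the fibre dimension, any orientations -/

section Raw

variable {m n : ℕ} {W X : SchemeOver ℂ}

/-- **`pr_{W!}(y ∪ pr_W^* x) = 0` for `deg y < 2 dim X`** (`pr_W : W ⊗ X → W`, any orientations `μ`, `ν` with `ν`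
satisfying Poincaré duality): `pr_{W!}(y ∪ pr_W^*x) ⌢ [W] = x ⌢ pr_{W*}(y ⌢ [W ⊗ X])` with
`pr_{W*}(y ⌢ [W ⊗ X]) ∈ H_{2(m+n) - deg y}(W(ℂ)) = 0` (`> 2 dim W`). [cite: FultonYoungTableaux1997, Appendix B §B.1 (5)–(6)]
[cite: HatcherAT2002, §3.3 Thm. 3.26 (c) and p. 241] -/
theorem gysinMap_cupProduct_map_eq_zero_of_lt (hW : IsSmoothProjective m W)
    (μ : HomologicalOrientation ℂ (ComplexPoints (W ⊗ X)) (2 * (m + n)))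
    (ν : HomologicalOrientation ℂ (ComplexPoints W) (2 * m)) (hν : ν.HasPoincareDuality)
    {a k s q b : ℕ} (hak : a + k = s) (hs : s + q = 2 * (m + n)) (hb : b + q = 2 * m) (hlt : a < 2 * n)
    (y : complexBetti (W ⊗ X) a) (x : complexBetti W k) :
    gysinMap μ ν (AlgPoints.mapContinuous (L := ℂ) (fst W X)) hs hb
      (cupProduct hak y (complexBetti.map (fst W X) k x)) = 0 := by
  apply (hν hb).1
  rw [map_zero, poincareDualityMap_apply, capProduct_gysinMap hν _ hs hb,
    cupProduct_capProduct hak hs (rfl : k + q = k + q) (show a + (k + q) = 2 * (m + n) by omega)]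
  change singularHomology.map ℂ ℂ (AlgPoints.mapContinuous (L := ℂ) (fst W X)) q
    (capProduct rfl (singularCohomology.map ℂ ℂ (AlgPoints.mapContinuous (L := ℂ) (fst W X)) k x) _) = 0
  rw [capProduct_map]
  have h0 : singularHomology.map ℂ ℂ (AlgPoints.mapContinuous (L := ℂ) (fst W X)) (k + q)
      (capProduct (show a + (k + q) = 2 * (m + n) by omega) y μ.fundamentalClass) = 0 := by
    haveI := ModuleCat.subsingleton_of_isZero
      (ComplexPoints.isZero_singularHomology_of_lt hW ℂ ℂ (show 2 * m < k + q by omega))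
    exact Subsingleton.elim _ _
  rw [h0, map_zero]

/-- The same with the pulled-back class on the left: `pr_{W!}(pr_W^* x ∪ y) = 0` for `deg y < 2 dim X`.
[cite: FultonYoungTableaux1997, Appendix B §B.1 (5)–(6)] [cite: HatcherAT2002, §3.2 Thm. 3.11] -/
theorem gysinMap_map_cupProduct_eq_zero_of_lt (hW : IsSmoothProjective m W)
    (μ : HomologicalOrientation ℂ (ComplexPoints (W ⊗ X)) (2 * (m + n)))
    (ν : HomologicalOrientation ℂ (ComplexPoints W) (2 * m)) (hν : ν.HasPoincareDuality)
    {a k s q b : ℕ} (hka : k + a = s) (hs : s + q = 2 * (m + n)) (hb : b + q = 2 * m) (hlt : a < 2 * n)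
    (x : complexBetti W k) (y : complexBetti (W ⊗ X) a) :
    gysinMap μ ν (AlgPoints.mapContinuous (L := ℂ) (fst W X)) hs hb
      (cupProduct hka (complexBetti.map (fst W X) k x) y) = 0 := by
  rw [cupProduct_gradedComm_holds ℂ _ hka (show a + k = s by omega), map_smul,
    gysinMap_cupProduct_map_eq_zero_of_lt hW μ ν hν (show a + k = s by omega) hs hb hlt y x, smul_zero]

end Raw

/-! ## §3 Balanced up to a fibre-killed class (in particular proportionally balanced) -/

/-- **No-go, balanced up to a fibre-killed class (restriction form).** Let `γ ∈ H^{2e}((𝒳 ⊗ 𝒳)(ℂ))` satisfy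
`γ ∪ pr₂^*[𝒳_{t₀}] = γ ∪ pr₁^* G` for some `G ∈ H²(𝒳)` dying on every fibre (`j_s^* G = 0` for all `s`: e.g.
`G = c · [𝒳_{t₁}]`, or any class of `L¹H²`). Then `j_s^*(γ^*(L_t W)) = 0` for all `W ∈ H²ᵖ(𝒳)`, `t`, `s`, for the
correspondence action `γ^*` in degrees `2p + 2 → 2p` and any orientations (part XV-a §2: `γ^*(W ∪ [𝒳_t]) =
γ^*_{2p→2p-2}(W) ∪ G`, resp. `= 0` for `p = 0`). [cite: Abdulali1994FamiliesAV, Conjecture 5.3 (p. 1130)]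
[cite: VoisinHodgeII2003, proof of Thm. 10.17 (10.7)] [cite: FultonYoungTableaux1997, Appendix B §B.1 (6)] -/
theorem map_fiberι_corrClassAction_fiberGysin_eq_zero_of_balanced' {d : ℕ} {f : 𝒳 ⟶ S}
    (hf : IsCompactAbelianPencil f d)
    (μ : HomologicalOrientation ℂ (ComplexPoints (𝒳 ⊗ 𝒳)) (2 * ((d + 1) + (d + 1))))
    (ν : HomologicalOrientation ℂ (ComplexPoints 𝒳) (2 * (d + 1))) (hν : ν.HasPoincareDuality)
    {p e q : ℕ} (hab : 2 * (p + 1) + 2 * e = 2 * p + 2 * (d + 1)) (hq : 2 * p + q = 2 * (d + 1))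
    (γ : complexBetti (𝒳 ⊗ 𝒳) (2 * e)) (t₀ : ComplexPoints S) (G : complexBetti 𝒳 (2 * (0 + 1)))
    (hG : ∀ s : ComplexPoints S, complexBetti.map (fiberι f s) (2 * (0 + 1)) G = 0)
    (hγ : cupProduct (Nat.add_comm (2 * e) (2 * (0 + 1))) γ (complexBetti.map (snd 𝒳 𝒳) (2 * (0 + 1))
        (fiberGysin hf t₀ 0 (singularCohomology.one ℂ (ComplexPoints (fiberOver f t₀))))) =
      cupProduct (Nat.add_comm (2 * e) (2 * (0 + 1))) γ (complexBetti.map (fst 𝒳 𝒳) (2 * (0 + 1)) G))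
    (W : complexBetti 𝒳 (2 * p)) (t s : ComplexPoints S) :
    complexBetti.map (fiberι f s) (2 * p)
      (corrClassAction μ ν hab hq γ (fiberGysin hf t p (complexBetti.map (fiberι f t) (2 * p) W))) = 0 := by
  rw [fiberGysin_map_fiberι_eq_cupProduct hf t W, fibreClassConstantOn_holds hf t t₀]
  rcases Nat.eq_zero_or_pos p with rfl | hp
  · rw [corrClassAction_cupProduct_eq_zero_of_balanced_of_lt hf.isSmoothProjective_total μ ν hν hab hq
      (show 2 * 0 + 2 * (0 + 1) = 2 * (0 + 1) by ring) (by omega) γ _ _ hγ W, map_zero]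
  · obtain ⟨p', rfl⟩ : ∃ p', p = p' + 1 := ⟨p - 1, by omega⟩
    rw [corrClassAction_cupProduct_of_balanced μ ν hν hab hq
      (show 2 * (p' + 1) + 2 * e = 2 * p' + 2 * (d + 1) by omega)
      (show 2 * p' + (2 * (0 + 1) + q) = 2 * (d + 1) by omega)
      (show 2 * (p' + 1) + 2 * (0 + 1) = 2 * (p' + 1 + 1) by ring) (show 2 * p' + 2 * (0 + 1) = 2 * (p' + 1) by ring)
      γ _ _ hγ W,
      complexBetti.map_cupProduct, hG s, map_zero]

/-- **No-go, balanced up to a fibre-killed class (witness form)**: such a `γ^*` witnesses no clause `p ≤ d` of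
`FibreClassLefschetzOn hf`. [cite: Abdulali1994FamiliesAV, Conjecture 5.3 and Theorem 5.5 (p. 1130)] -/
theorem not_fibreClassLefschetz_clause_of_balanced' {d : ℕ} {f : 𝒳 ⟶ S} (hf : IsCompactAbelianPencil f d)
    (μ : HomologicalOrientation ℂ (ComplexPoints (𝒳 ⊗ 𝒳)) (2 * ((d + 1) + (d + 1))))
    (ν : HomologicalOrientation ℂ (ComplexPoints 𝒳) (2 * (d + 1))) (hν : ν.HasPoincareDuality)
    {p e q : ℕ} (hab : 2 * (p + 1) + 2 * e = 2 * p + 2 * (d + 1)) (hq : 2 * p + q = 2 * (d + 1))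
    (γ : complexBetti (𝒳 ⊗ 𝒳) (2 * e)) (t₀ : ComplexPoints S) (G : complexBetti 𝒳 (2 * (0 + 1)))
    (hG : ∀ s : ComplexPoints S, complexBetti.map (fiberι f s) (2 * (0 + 1)) G = 0)
    (hγ : cupProduct (Nat.add_comm (2 * e) (2 * (0 + 1))) γ (complexBetti.map (snd 𝒳 𝒳) (2 * (0 + 1))
        (fiberGysin hf t₀ 0 (singularCohomology.one ℂ (ComplexPoints (fiberOver f t₀))))) =
      cupProduct (Nat.add_comm (2 * e) (2 * (0 + 1))) γ (complexBetti.map (fst 𝒳 𝒳) (2 * (0 + 1)) G))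
    (hp : p ≤ d) :
    ¬ ∀ (W : complexBetti 𝒳 (2 * p)) (t s : ComplexPoints S),
        complexBetti.map (fiberι f s) (2 * p)
          (corrClassAction μ ν hab hq γ (fiberGysin hf t p (complexBetti.map (fiberι f t) (2 * p) W))) =
          complexBetti.map (fiberι f s) (2 * p) W := by
  intro h
  obtain ⟨W, hW⟩ := exists_map_fiberι_ne_zero hf hp t₀
  exact hW (by rw [← h W t₀ t₀,
    map_fiberι_corrClassAction_fiberGysin_eq_zero_of_balanced' hf μ ν hν hab hq γ t₀ G hG hγ])

/-- **PROPORTIONALLY balanced correspondences** (`γ ∪ pr₂^*[𝒳_{t₀}] = c · (γ ∪ pr₁^*[𝒳_{t₁}])`, any scalar `c`,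
`c = 0` included — in print: cycles supported over a curve `C ⊂ S × S` finite over the first factor, the slices
over `C` being algebraically equivalent) **never witness a clause `p ≤ d` of (β′_f)** (`G := c · [𝒳_{t₁}]` in the
previous theorem). [cite: Abdulali1994FamiliesAV, Conjecture 5.3 (p. 1130)] [cite: Fulton1998, §10.3 Example 10.3.2] -/
theorem not_fibreClassLefschetz_clause_of_propBalanced {d : ℕ} {f : 𝒳 ⟶ S} (hf : IsCompactAbelianPencil f d)
    (μ : HomologicalOrientation ℂ (ComplexPoints (𝒳 ⊗ 𝒳)) (2 * ((d + 1) + (d + 1))))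
    (ν : HomologicalOrientation ℂ (ComplexPoints 𝒳) (2 * (d + 1))) (hν : ν.HasPoincareDuality)
    {p e q : ℕ} (hab : 2 * (p + 1) + 2 * e = 2 * p + 2 * (d + 1)) (hq : 2 * p + q = 2 * (d + 1))
    (γ : complexBetti (𝒳 ⊗ 𝒳) (2 * e)) (t₀ t₁ : ComplexPoints S) (c : ℂ)
    (hγ : cupProduct (Nat.add_comm (2 * e) (2 * (0 + 1))) γ (complexBetti.map (snd 𝒳 𝒳) (2 * (0 + 1))
        (fiberGysin hf t₀ 0 (singularCohomology.one ℂ (ComplexPoints (fiberOver f t₀))))) =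
      c • cupProduct (Nat.add_comm (2 * e) (2 * (0 + 1))) γ (complexBetti.map (fst 𝒳 𝒳) (2 * (0 + 1))
        (fiberGysin hf t₁ 0 (singularCohomology.one ℂ (ComplexPoints (fiberOver f t₁))))))
    (hp : p ≤ d) :
    ¬ ∀ (W : complexBetti 𝒳 (2 * p)) (t s : ComplexPoints S),
        complexBetti.map (fiberι f s) (2 * p)
          (corrClassAction μ ν hab hq γ (fiberGysin hf t p (complexBetti.map (fiberι f t) (2 * p) W))) =
          complexBetti.map (fiberι f s) (2 * p) W :=
  not_fibreClassLefschetz_clause_of_balanced' hf μ ν hν hab hq γ t₀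
    (c • fiberGysin hf t₁ 0 (singularCohomology.one ℂ (ComplexPoints (fiberOver f t₁))))
    (fun s ↦ by rw [map_smul, map_fiberι_fiberGysin_one_eq_zero hf t₁ s, smul_zero])
    (by rw [hγ, map_smul, map_smul]) hp

/-! ## §4 Correspondences through a fibre of the SECOND projection: `γ = pr₂^*(j_{t₁*} a) ∪ γ₁` -/

/-- **`γ^* ∘ L_t = 0` for `γ = pr₂^*(j_{t₁*} a) ∪ γ₁`** (a class "supported on `𝒳 × 𝒳_{t₁}`", in any degree, any
orientations): `pr₂^*(W ∪ [𝒳_t]) ∪ pr₂^*(j_{t₁*}a) ∪ γ₁ = pr₂^*(W ∪ ([𝒳_{t₁}] ∪ j_{t₁*}a)) ∪ γ₁ = 0` by §1.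
[cite: VoisinHodgeII2003, proof of Thm. 10.17 (10.7)] [cite: Fulton1998, §10.3 Example 10.3.2] -/
theorem corrClassAction_fiberGysin_eq_zero_of_sndVertical {d : ℕ} {f : 𝒳 ⟶ S} (hf : IsCompactAbelianPencil f d)
    (μ : HomologicalOrientation ℂ (ComplexPoints (𝒳 ⊗ 𝒳)) (2 * ((d + 1) + (d + 1))))
    (ν : HomologicalOrientation ℂ (ComplexPoints 𝒳) (2 * (d + 1)))
    {p r e₁ e b q : ℕ} (he : 2 * (r + 1) + 2 * e₁ = 2 * e) (hab : 2 * (p + 1) + 2 * e = b + 2 * (d + 1))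
    (hq : b + q = 2 * (d + 1)) (t₁ : ComplexPoints S) (a : complexBetti (fiberOver f t₁) (2 * r))
    (γ₁ : complexBetti (𝒳 ⊗ 𝒳) (2 * e₁)) (W : complexBetti 𝒳 (2 * p)) (t : ComplexPoints S) :
    corrClassAction μ ν hab hq
      (cupProduct he (complexBetti.map (snd 𝒳 𝒳) (2 * (r + 1)) (fiberGysin hf t₁ r a)) γ₁)
      (fiberGysin hf t p (complexBetti.map (fiberι f t) (2 * p) W)) = 0 := by
  rw [fiberGysin_map_fiberι_eq_cupProduct hf t W, fibreClassConstantOn_holds hf t t₁, corrClassAction_apply,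
    ← cupProduct_assoc (rfl : 2 * (p + 1) + 2 * (r + 1) = 2 * (p + 1) + 2 * (r + 1)) he
      (show 2 * (p + 1) + 2 * (r + 1) + 2 * e₁ = 2 * (p + 1) + 2 * e by omega) rfl,
    ← complexBetti.map_cupProduct,
    cupProduct_assoc (show 2 * p + 2 * (0 + 1) = 2 * (p + 1) by ring)
      (show 2 * (0 + 1) + 2 * (r + 1) = 2 * (r + 1 + 1) by ring) rfl
      (show 2 * p + 2 * (r + 1 + 1) = 2 * (p + 1) + 2 * (r + 1) by ring),
    cupProduct_gradedComm_holds ℂ _ (show 2 * (0 + 1) + 2 * (r + 1) = 2 * (r + 1 + 1) by ring)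
      (show 2 * (r + 1) + 2 * (0 + 1) = 2 * (r + 1 + 1) by ring),
    cupProduct_fiberGysin_fiberGysin_one_eq_zero hf t₁ a, smul_zero, map_zero, map_zero, map_zero,
    LinearMap.zero_apply, map_zero]

/-! ## §5 Correspondences through a fibre of the FIRST projection: `γ = pr₁^*(j_{t₁*} a) ∪ γ₁` -/

/-- **`j_s^* ∘ γ^* = 0` on every class, for `γ = pr₁^*(j_{t₁*} a) ∪ γ₁`** (a class "supported on `𝒳_{t₁} × 𝒳`";
degrees `k → b`, any orientations with `ν` Poincaré): `pr₂^* y ∪ (pr₁^*J ∪ γ₁) = pr₁^*J ∪ (pr₂^*y ∪ γ₁)`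
(`J = j_{t₁*}a` has even degree); if `b ≥ deg J` the projection formula `pr_{1!}(pr₁^*J ∪ Y) = J ∪ pr_{1!}Y`
(Fulton (6), `gysinMap_map_cupProduct`) and `j_s^* J = 0` (§1) conclude; if `b < deg J` then `deg Y < 2 dim 𝒳` and
`pr_{1!}(pr₁^* J ∪ Y) = 0` already (§2). [cite: FultonYoungTableaux1997, Appendix B §B.1 (6)]
[cite: VoisinHodgeII2003, proof of Thm. 10.17 (10.7)] [cite: HatcherAT2002, §3.2 Thm. 3.11] -/
theorem map_fiberι_corrClassAction_eq_zero_of_fstVertical {d : ℕ} {f : 𝒳 ⟶ S} (hf : IsCompactAbelianPencil f d)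
    (μ : HomologicalOrientation ℂ (ComplexPoints (𝒳 ⊗ 𝒳)) (2 * ((d + 1) + (d + 1))))
    (ν : HomologicalOrientation ℂ (ComplexPoints 𝒳) (2 * (d + 1))) (hν : ν.HasPoincareDuality)
    {k r e₁ e b q : ℕ} (he : 2 * (r + 1) + 2 * e₁ = 2 * e) (hab : k + 2 * e = b + 2 * (d + 1))
    (hq : b + q = 2 * (d + 1)) (t₁ : ComplexPoints S) (a : complexBetti (fiberOver f t₁) (2 * r))
    (γ₁ : complexBetti (𝒳 ⊗ 𝒳) (2 * e₁)) (y : complexBetti 𝒳 k) (s : ComplexPoints S) :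
    complexBetti.map (fiberι f s) b (corrClassAction μ ν hab hq
      (cupProduct he (complexBetti.map (fst 𝒳 𝒳) (2 * (r + 1)) (fiberGysin hf t₁ r a)) γ₁) y) = 0 := by
  rw [corrClassAction_apply,
    ← cupProduct_assoc (rfl : k + 2 * (r + 1) = k + 2 * (r + 1)) he
      (show k + 2 * (r + 1) + 2 * e₁ = k + 2 * e by omega) rfl,
    cupProduct_gradedComm_holds ℂ _ (rfl : k + 2 * (r + 1) = k + 2 * (r + 1))
      (show 2 * (r + 1) + k = k + 2 * (r + 1) by omega) (complexBetti.map (snd 𝒳 𝒳) k y),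
    Even.neg_one_pow ⟨k * (r + 1), by ring⟩, one_smul,
    cupProduct_assoc (show 2 * (r + 1) + k = k + 2 * (r + 1) by omega) (rfl : k + 2 * e₁ = k + 2 * e₁)
      (show k + 2 * (r + 1) + 2 * e₁ = k + 2 * e by omega) (show 2 * (r + 1) + (k + 2 * e₁) = k + 2 * e by omega)]
  by_cases hb : 2 * (r + 1) ≤ b
  · obtain ⟨b', rfl⟩ : ∃ b', b = 2 * (r + 1) + b' := ⟨b - 2 * (r + 1), by omega⟩
    have hproj := gysinMap_map_cupProduct (R := ℂ) (μY := μ) (μX := ν) hν ⟨(d + 1) + (d + 1) + (d + 1), by ring⟩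
      (AlgPoints.mapContinuous (L := ℂ) (fst 𝒳 𝒳))
      (show 2 * (r + 1) + (k + 2 * e₁) = k + 2 * e by omega) (show k + 2 * e + q = 2 * ((d + 1) + (d + 1)) by omega)
      hq (rfl : 2 * (r + 1) + q = 2 * (r + 1) + q)
      (show k + 2 * e₁ + (2 * (r + 1) + q) = 2 * ((d + 1) + (d + 1)) by omega)
      (show b' + (2 * (r + 1) + q) = 2 * (d + 1) by omega) (rfl : 2 * (r + 1) + b' = 2 * (r + 1) + b')
      (fiberGysin hf t₁ r a) (cupProduct rfl (complexBetti.map (snd 𝒳 𝒳) k y) γ₁)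
    have hproj' : gysinMap μ ν (AlgPoints.mapContinuous (L := ℂ) (fst 𝒳 𝒳))
        (show k + 2 * e + q = 2 * ((d + 1) + (d + 1)) by omega) hq
        (cupProduct (show 2 * (r + 1) + (k + 2 * e₁) = k + 2 * e by omega)
          (complexBetti.map (fst 𝒳 𝒳) (2 * (r + 1)) (fiberGysin hf t₁ r a))
          (cupProduct rfl (complexBetti.map (snd 𝒳 𝒳) k y) γ₁)) =
        cupProduct (rfl : 2 * (r + 1) + b' = 2 * (r + 1) + b') (fiberGysin hf t₁ r a)
          (gysinMap μ ν (AlgPoints.mapContinuous (L := ℂ) (fst 𝒳 𝒳))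
            (show k + 2 * e₁ + (2 * (r + 1) + q) = 2 * ((d + 1) + (d + 1)) by omega)
            (show b' + (2 * (r + 1) + q) = 2 * (d + 1) by omega)
            (cupProduct rfl (complexBetti.map (snd 𝒳 𝒳) k y) γ₁)) := hproj
    rw [hproj', map_fiberι_cupProduct_fiberGysin_eq_zero' hf t₁ s a]
  · rw [gysinMap_map_cupProduct_eq_zero_of_lt hf.isSmoothProjective_total μ ν hν
      (show 2 * (r + 1) + (k + 2 * e₁) = k + 2 * e by omega) (show k + 2 * e + q = 2 * ((d + 1) + (d + 1)) by omega)
      hq (show k + 2 * e₁ < 2 * (d + 1) by omega), map_zero]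

end Summit.HodgeConjecture.HodgeConjecture.Ring2.AbelianAll

end
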